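import Literature.InformationTheory.QuantumCodes.PlanarCodeLossErrorSkeletonSum
import Literature.InformationTheory.QuantumCodes.LossThresholdOneArm
import Literature.InformationTheory.QuantumCodes.ToricCodeLossErrorPhaseBoundary
import HarnessLib

/-!
# Planar surface code under losses AND errors, IV: a positive error threshold for EVERY loss rate below `1/2`

Topic `Literature/InformationTheory/QuantumCodes` (venture QEC, LADDER-QEC rung Q5; qec-type-03). All PROVED, no named fact, kernel
axioms. Planar companion of `ToricCodeLossErrorPhaseBoundary.lean` (Stace–Barrett–Doherty's phase diagram, "planar codes, by
extension"; Stace–Barrett 2010): the Peierls argument on the degraded lattice along rough-to-rough crossing paths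
(`PlanarCodeLossErrorRuns/Skeletons/SkeletonSum.lean`).

* **`planar_mixedFailureProb_le_of_oneArmDecay`** (finite size): for the `k`-th planar code, a minimum-weight-outside-the-losses
  decoder, a loss rate `y` at which the one-arm probabilities of bond percolation decay like `e^{-cn}`, an error rate
  `0 ≤ p ≤ planarFlipThreshold c`, and granted the odd-crossing property of the non-trivial logicals of the sector (`k = 1`;
  hypothesis `hk1`, discharged Summits-side from `planar_logical_add_string_mem`):
  `Prob[failure] ≤ 2 (k+2) K(c) e^{-c(k+3)/4}`;
* **`planar_mixedFamily_decaysExponentially_of_oddCrossing`** — for every loss rate `0 ≤ y < 1/2` there is `p₀ > 0` (Kesten's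
  decay rate fed through the Peierls constant) such that for every family of minimum-weight-outside-the-losses decoders of planar
  codes with the odd-crossing property and every `p ≤ p₀`, the failure probability decays exponentially in `k`.

## References

* [StaceBarrettDoherty2009] T. M. Stace, S. D. Barrett, A. C. Doherty, PRL 102 (2009) 200501, p. 2–3 and Fig. 2.
* [StaceBarrett2010] T. M. Stace, S. D. Barrett, PRA 81 (2010) 022317, arXiv:0912.1159 (planar code with loss and errors).
* [KestenCMP1980] H. Kesten, Comm. Math. Phys. 74 (1980) 41–59, Thm. 2 (1.7).
* [DennisEtAl2002] Dennis–Kitaev–Landahl–Preskill, J. Math. Phys. 43 (2002) 4452, §5.3 (relative polygons).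
-/

namespace Literature.InformationTheory.QuantumCodes

namespace PlanarCode

open Finset Matrix Filter Topology
open Literature.Probability.LatticeModels (zdGraph)
open Literature.Probability.Percolation (siteToBoundary bondPercolation Kesten1980_expDecay)

variable {k : ℕ}

/-! ### The constants -/

/-- The planar Peierls constant `K(c) = 4 e^{c/4} (16/c + 3)² / (1 - e^{-c/4})`, a `k`-independent bound for `pstepSum c k` and
`plastSum c k`. [cite: DennisEtAl2002, §5.3 (the constant in the Peierls sum)] -/
noncomputable def planarPeierlsConst (c : ℝ) : ℝ :=
  4 * Real.exp (c / 4) * (16 / c + 3) ^ 2 / (1 - Real.exp (-(c / 4)))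

/-- The planar error-rate threshold function `p₀(c) = (4 K(c))^{-2}`: for `p ≤ p₀(c)` the Peierls ratio `2√p · K(c)` is `≤ 1/2`.
[cite: StaceBarrettDoherty2009, p. 3 (a finite error threshold for p_loss < 0.5)] -/
noncomputable def planarFlipThreshold (c : ℝ) : ℝ := (1 / (4 * planarPeierlsConst c)) ^ 2

/-- Polynomial versus exponential: `(2R+1)² ≤ (16/c + 3)² e^{(c/4)R}` for `c > 0`. [folklore] -/
private theorem sq_le_const_mul_exp' {c : ℝ} (hc : 0 < c) (R : ℕ) :
    ((2 * R + 1 : ℕ) : ℝ) ^ 2 ≤ (16 / c + 3) ^ 2 * Real.exp (c / 4 * R) := by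
  have h1 : c / 8 * R + 1 ≤ Real.exp (c / 8 * R) := Real.add_one_le_exp _
  have hE1 : 1 ≤ Real.exp (c / 8 * R) := Real.one_le_exp (by positivity)
  have hR : (R : ℝ) ≤ 8 / c * Real.exp (c / 8 * R) := by
    rw [div_mul_eq_mul_div, le_div_iff₀ hc]
    nlinarith
  have h2 : ((2 * R + 1 : ℕ) : ℝ) ≤ (16 / c + 3) * Real.exp (c / 8 * R) := by
    push_cast
    have : (1 : ℝ) ≤ 3 * Real.exp (c / 8 * R) := by nlinarith
    have h16 : 2 * (8 / c * Real.exp (c / 8 * R)) = 16 / c * Real.exp (c / 8 * R) := by ring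
    nlinarith
  have h0 : 0 ≤ ((2 * R + 1 : ℕ) : ℝ) := Nat.cast_nonneg _
  have hsq : Real.exp (c / 8 * R) ^ 2 = Real.exp (c / 4 * R) := by
    rw [← Real.exp_nat_mul]; congr 1; ring
  calc ((2 * R + 1 : ℕ) : ℝ) ^ 2 ≤ ((16 / c + 3) * Real.exp (c / 8 * R)) ^ 2 := pow_le_pow_left₀ h0 h2 2
    _ = (16 / c + 3) ^ 2 * Real.exp (c / 4 * R) := by rw [mul_pow, hsq]

/-- The finite geometric sum `Σ_{R<N} e^{-(c/4)R} ≤ 1/(1 - e^{-c/4})`. [folklore] -/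
private theorem sum_exp_neg_le' {c : ℝ} (hc : 0 < c) (N : ℕ) :
    ∑ R ∈ range N, Real.exp (-(c / 4)) ^ R ≤ 1 / (1 - Real.exp (-(c / 4))) := by
  have hlt : Real.exp (-(c / 4)) < 1 := Real.exp_lt_one_iff.2 (by linarith)
  have h := geom_tail_le (Real.exp_pos (-(c / 4))).le hlt 0 N
  rwa [pow_zero, ← Finset.range_eq_Ico] at h

/-- `K(c) > 0` for `c > 0`. [cite: DennisEtAl2002, §5.3] -/
theorem planarPeierlsConst_pos {c : ℝ} (hc : 0 < c) : 0 < planarPeierlsConst c := by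
  unfold planarPeierlsConst
  have h1 : Real.exp (-(c / 4)) < 1 := Real.exp_lt_one_iff.2 (by linarith)
  have h2 : 0 < 16 / c + 3 := by positivity
  have := Real.exp_pos (c / 4)
  positivity

/-- `pstepSum c k ≤ K(c)` uniformly in `k` (`c > 0`). [cite: DennisEtAl2002, §5.3] -/
theorem pstepSum_le_planarPeierlsConst {c : ℝ} (hc : 0 < c) (k : ℕ) : pstepSum c k ≤ planarPeierlsConst c := by
  have hq1 : Real.exp (-(c / 4)) < 1 := Real.exp_lt_one_iff.2 (by linarith)
  have hden : 0 < 1 - Real.exp (-(c / 4)) := by linarith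
  have hterm : ∀ R : ℕ, 4 * ((2 * R + 1 : ℕ) : ℝ) ^ 2 * prunWeight c R ≤
      4 * Real.exp (c / 4) * (16 / c + 3) ^ 2 * Real.exp (-(c / 4)) ^ R := by
    intro R
    have h1 := sq_le_const_mul_exp' hc R
    have hw : prunWeight c R = Real.exp (c / 4) * (Real.exp (-(c / 4)) ^ R * Real.exp (-(c / 4 * R))) := by
      rw [prunWeight, ← Real.exp_nat_mul, ← Real.exp_add, ← Real.exp_add]
      congr 1; ring
    have hprod : Real.exp (c / 4 * R) * Real.exp (-(c / 4 * R)) = 1 := by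
      rw [← Real.exp_add, add_neg_cancel, Real.exp_zero]
    have hpos1 : 0 < Real.exp (c / 4) := Real.exp_pos _
    have hpos2 : 0 < Real.exp (-(c / 4)) ^ R := pow_pos (Real.exp_pos _) R
    have hpos3 : 0 < Real.exp (-(c / 4 * R)) := Real.exp_pos _
    rw [hw]
    have key : ((2 * R + 1 : ℕ) : ℝ) ^ 2 * Real.exp (-(c / 4 * R)) ≤ (16 / c + 3) ^ 2 := by
      have := mul_le_mul_of_nonneg_right h1 hpos3.le
      rwa [mul_assoc, hprod, mul_one] at this
    nlinarith [mul_le_mul_of_nonneg_left key (mul_pos hpos1 hpos2).le]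
  calc pstepSum c k = ∑ R ∈ range (k + 3), 4 * ((2 * R + 1 : ℕ) : ℝ) ^ 2 * prunWeight c R := rfl
    _ ≤ ∑ R ∈ range (k + 3), 4 * Real.exp (c / 4) * (16 / c + 3) ^ 2 * Real.exp (-(c / 4)) ^ R :=
        Finset.sum_le_sum fun R _ => hterm R
    _ = 4 * Real.exp (c / 4) * (16 / c + 3) ^ 2 * ∑ R ∈ range (k + 3), Real.exp (-(c / 4)) ^ R := by
        rw [Finset.mul_sum]
    _ ≤ 4 * Real.exp (c / 4) * (16 / c + 3) ^ 2 * (1 / (1 - Real.exp (-(c / 4)))) :=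
        mul_le_mul_of_nonneg_left (sum_exp_neg_le' hc _) (by positivity)
    _ = planarPeierlsConst c := by rw [planarPeierlsConst]; ring

/-- `plastSum c k ≤ K(c)` uniformly in `k` (`c > 0`). [cite: DennisEtAl2002, §5.3] -/
theorem plastSum_le_planarPeierlsConst {c : ℝ} (hc : 0 < c) (k : ℕ) : plastSum c k ≤ planarPeierlsConst c := by
  have hq1 : Real.exp (-(c / 4)) < 1 := Real.exp_lt_one_iff.2 (by linarith)
  have hden : 0 < 1 - Real.exp (-(c / 4)) := by linarith
  have hterm : ∀ R : ℕ, prunWeight c R ≤ Real.exp (c / 4) * Real.exp (-(c / 4)) ^ R := by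
    intro R
    rw [prunWeight, ← Real.exp_nat_mul, ← Real.exp_add]
    apply Real.exp_le_exp.2
    have : 0 ≤ c / 4 * R := by positivity
    nlinarith
  calc plastSum c k = ∑ R ∈ range (k + 3), prunWeight c R := rfl
    _ ≤ ∑ R ∈ range (k + 3), Real.exp (c / 4) * Real.exp (-(c / 4)) ^ R := Finset.sum_le_sum fun R _ => hterm R
    _ = Real.exp (c / 4) * ∑ R ∈ range (k + 3), Real.exp (-(c / 4)) ^ R := by rw [Finset.mul_sum]
    _ ≤ Real.exp (c / 4) * (1 / (1 - Real.exp (-(c / 4)))) :=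
        mul_le_mul_of_nonneg_left (sum_exp_neg_le' hc _) (Real.exp_pos _).le
    _ ≤ 4 * Real.exp (c / 4) * (16 / c + 3) ^ 2 * (1 / (1 - Real.exp (-(c / 4)))) := by
        have h9 : (1 : ℝ) ≤ 4 * (16 / c + 3) ^ 2 := by
          have : (3 : ℝ) ≤ 16 / c + 3 := by have := div_pos (by norm_num : (0:ℝ) < 16) hc; linarith
          nlinarith
        have hpos : 0 ≤ Real.exp (c / 4) * (1 / (1 - Real.exp (-(c / 4)))) := by positivity
        nlinarith
    _ = planarPeierlsConst c := by rw [planarPeierlsConst]; ring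

/-- `p₀(c) > 0`. [cite: StaceBarrettDoherty2009, p. 3] -/
theorem planarFlipThreshold_pos {c : ℝ} (hc : 0 < c) : 0 < planarFlipThreshold c := by
  unfold planarFlipThreshold
  have := planarPeierlsConst_pos hc
  positivity

/-- For `p ≤ p₀(c)` the Peierls ratio is at most `1/2`: `K(c) (2√p) ≤ 1/2`. [cite: DennisEtAl2002, §5.3] -/
theorem planar_ratio_le_half {c : ℝ} (hc : 0 < c) {p : ℝ} (hp : p ≤ planarFlipThreshold c) :
    planarPeierlsConst c * (2 * Real.sqrt p) ≤ 1 / 2 := by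
  have hK := planarPeierlsConst_pos hc
  have hA : 0 < 4 * planarPeierlsConst c := by positivity
  have hs : Real.sqrt p ≤ 1 / (4 * planarPeierlsConst c) := by
    rw [← Real.sqrt_sq (le_of_lt (by positivity : (0 : ℝ) < 1 / (4 * planarPeierlsConst c)))]
    exact Real.sqrt_le_sqrt hp
  calc planarPeierlsConst c * (2 * Real.sqrt p)
      ≤ planarPeierlsConst c * (2 * (1 / (4 * planarPeierlsConst c))) := by gcongr
    _ = 1 / 2 := by field_simp; ring

/-! ### The finite-size bound -/

open Classical in
/-- **Finite-size bound (planar Peierls argument on the degraded lattice).** The `k`-th planar surface code; its non-trivial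
`Z`-logicals cross the bottom rough boundary an odd number of times (`hk1`, the `k = 1` property); a
minimum-weight-outside-the-losses decoder `D`; a loss rate `y ∈ [0,1]` at which `P_y(0 ↔ ∂B(n)) ≤ e^{-cn}` (`c > 0`); an error
rate `0 ≤ p ≤ p₀(c)`, `p ≤ 1`. Then `Prob[failure under losses y and errors p] ≤ 2 (k+2) K(c) e^{-c(k+3)/4}`.
[cite: StaceBarrettDoherty2009, p. 2–3 and Fig. 2] [cite: DennisEtAl2002, §5.3] -/
theorem planar_mixedFailureProb_le_of_oneArmDecay
    (hk1 : ∀ x : PlanarQubit k → ZMod 2, planarHX k *ᵥ x = 0 → x ∉ planarSZ k →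
      ∑ b : Fin (k + 2), x (Sum.inl (0, b)) = 1)
    {D : ErasureDecoder (PlanarQubit k) (PlanarCheck k → ZMod 2)} (hD : D.IsMinWeightOutside (planarHX k))
    (y : unitInterval) {c : ℝ} (hc : 0 < c)
    (hdec : ∀ n : ℕ, (bondPercolation (zdGraph 2) y).real (siteToBoundary 2 n) ≤ Real.exp (-c * n))
    {p : ℝ} (hp0 : 0 ≤ p) (hp : p ≤ planarFlipThreshold c) (hp1 : p ≤ 1) :
    mixedFailureProb (planarHX k) (planarSZ k : Set (PlanarQubit k → ZMod 2)) D y p ≤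
      2 * ((k : ℝ) + 2) * planarPeierlsConst c * Real.exp (-c * ((k : ℝ) + 3) / 4) := by
  have hy0 : 0 ≤ (y : ℝ) := y.2.1
  have hy1 : (y : ℝ) ≤ 1 := y.2.2
  set M := Fintype.card (PlanarQubit k) with hM
  let ι := Σ m : Fin (M + 1), PSkel k m
  let A : ι → Finset (PlanarQubit k) → Prop := fun σ Er => σ.2.Valid ∧ σ.2.lossEvent Er
  let B : ι → Finset (PlanarQubit k) → Prop := fun σ E => σ.2.flipEvent E
  -- Step 1: the product union bound
  let F : Finset (PlanarQubit k) → Finset (PlanarQubit k) → Prop := fun Er E =>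
    ∃ e : PlanarQubit k → ZMod 2, supp e \ Er = E \ Er ∧
      ¬ D.Corrects (fun e => planarHX k *ᵥ e) (planarSZ k : Set (PlanarQubit k → ZMod 2)) Er e
  have hcover : ∀ Er E, F Er E → ∃ σ ∈ (univ : Finset ι), A σ Er ∧ B σ E := by
    intro Er E hF
    obtain ⟨e, heE, hfail⟩ := hF
    have hsyn : planarHX k *ᵥ D Er (planarHX k *ᵥ e) = planarHX k *ᵥ e := (hD Er e).1
    have hres : planarHX k *ᵥ (D Er (planarHX k *ᵥ e) + e) = 0 := by
      rw [Matrix.mulVec_add, hsyn]; funext i; exact CharTwo.add_self_eq_zero _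
    have hodd := hk1 _ hres hfail
    obtain ⟨m, hm, s, hval, hloss, hflip⟩ := exists_pskeleton_of_oddResidual hD hodd heE
    exact ⟨⟨⟨m, Nat.lt_succ_of_le hm⟩, s⟩, mem_univ _, ⟨hval, hloss⟩, hflip⟩
  have h1' := sum_mul_sum_filter_le_of_cover univ A B F hcover hy0 hy1 hp0 hp1
  have h1 : mixedFailureProb (planarHX k) (planarSZ k : Set (PlanarQubit k → ZMod 2)) D y p ≤
      ∑ σ ∈ (univ : Finset ι), eventProb (A σ) y * eventProb (B σ) p := by
    unfold mixedFailureProb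
    convert h1' using 6
  -- Step 2: price each skeleton
  set θ : ℝ := 2 * Real.sqrt p with hθ
  have hθ0 : 0 ≤ θ := by positivity
  let W : ι → ℝ := fun σ =>
    if σ.2.Valid then (∏ j ∈ range (σ.1 + 1), Real.exp (-c * PSkel.rad σ.2 j)) * θ ^ (σ.1 : ℕ) else 0
  have h2 : ∀ σ : ι, eventProb (A σ) y * eventProb (B σ) p ≤ W σ := by
    intro σ
    by_cases hv : σ.2.Valid
    · have hA : eventProb (A σ) y ≤ ∏ j ∈ range (σ.1 + 1), Real.exp (-c * PSkel.rad σ.2 j) := by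
        calc eventProb (A σ) y ≤ eventProb (PSkel.lossEvent σ.2) y := eventProb_mono (fun Er h => h.2) hy0 hy1
          _ ≤ _ := PSkel.eventProb_lossEvent_le σ.2 y hdec
      have hB : eventProb (B σ) p ≤ θ ^ (σ.1 : ℕ) := PSkel.eventProb_flipEvent_le σ.2 hp0 hp1
      simp only [W, if_pos hv]
      exact mul_le_mul hA hB (eventProb_nonneg _ hp0 hp1) (Finset.prod_nonneg fun j _ => (Real.exp_pos _).le)
    · have hA : eventProb (A σ) y = 0 := by
        have : eventProb (A σ) y ≤ eventProb (fun _ : Finset (PlanarQubit k) => False) y :=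
          eventProb_mono (fun Er h => hv h.1) hy0 hy1
        rw [eventProb_false] at this
        exact le_antisymm this (eventProb_nonneg _ hy0 hy1)
      simp only [W, if_neg hv, hA, zero_mul, le_refl]
  -- Step 3: the Peierls sum, size by size
  set ρ : ℝ := pstepSum c k * θ with hρ
  have hρ0 : 0 ≤ ρ := by have := pstepSum_nonneg c k; positivity
  have hρhalf : ρ ≤ 1 / 2 := by
    calc ρ ≤ planarPeierlsConst c * θ := mul_le_mul_of_nonneg_right (pstepSum_le_planarPeierlsConst hc k) hθ0
      _ ≤ 1 / 2 := planar_ratio_le_half hc hp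
  have h3 : ∑ σ : ι, W σ ≤ ((k : ℝ) + 2) * plastSum c k * Real.exp (-c * ((k : ℝ) + 3) / 4) *
      ∑ m ∈ range (M + 1), ρ ^ m := by
    have hsplit : ∑ σ : ι, W σ = ∑ m : Fin (M + 1), ∑ s ∈ (univ : Finset (PSkel k m)).filter PSkel.Valid,
        (∏ j ∈ range (m + 1), Real.exp (-c * PSkel.rad s j)) * θ ^ (m : ℕ) := by
      rw [Fintype.sum_sigma]
      refine Finset.sum_congr rfl fun m _ => ?_
      rw [Finset.sum_filter]
    rw [hsplit, Finset.mul_sum, ← Fin.sum_univ_eq_sum_range]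
    refine Finset.sum_le_sum fun m _ => ?_
    have := sum_pskeleton_weight_le (k := k) (m : ℕ) hc.le hθ0
    rw [← hρ] at this
    exact this
  have hgeom : ∑ m ∈ range (M + 1), ρ ^ m ≤ 2 := by
    have h := geom_tail_le hρ0 (by linarith) 0 (M + 1)
    rw [pow_zero, ← Finset.range_eq_Ico] at h
    calc ∑ m ∈ range (M + 1), ρ ^ m ≤ 1 / (1 - ρ) := h
      _ ≤ 2 := by rw [div_le_iff₀ (by linarith)]; linarith
  have hK0 := plastSum_le_planarPeierlsConst hc k
  have hK0' := plastSum_nonneg c k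
  calc mixedFailureProb (planarHX k) (planarSZ k : Set (PlanarQubit k → ZMod 2)) D y p
      ≤ ∑ σ ∈ (univ : Finset ι), eventProb (A σ) y * eventProb (B σ) p := h1
    _ ≤ ∑ σ : ι, W σ := Finset.sum_le_sum fun σ _ => h2 σ
    _ ≤ ((k : ℝ) + 2) * plastSum c k * Real.exp (-c * ((k : ℝ) + 3) / 4) * ∑ m ∈ range (M + 1), ρ ^ m := h3
    _ ≤ ((k : ℝ) + 2) * planarPeierlsConst c * Real.exp (-c * ((k : ℝ) + 3) / 4) * 2 := by
        have h0 : 0 ≤ ((k : ℝ) + 2) * Real.exp (-c * ((k : ℝ) + 3) / 4) := by positivity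
        have hs0 : 0 ≤ ∑ m ∈ range (M + 1), ρ ^ m := Finset.sum_nonneg fun m _ => pow_nonneg hρ0 m
        calc ((k : ℝ) + 2) * plastSum c k * Real.exp (-c * ((k : ℝ) + 3) / 4) * ∑ m ∈ range (M + 1), ρ ^ m
            = (((k : ℝ) + 2) * Real.exp (-c * ((k : ℝ) + 3) / 4)) * (plastSum c k * ∑ m ∈ range (M + 1), ρ ^ m) := by
              ring
          _ ≤ (((k : ℝ) + 2) * Real.exp (-c * ((k : ℝ) + 3) / 4)) * (planarPeierlsConst c * 2) :=
              mul_le_mul_of_nonneg_left (mul_le_mul hK0 hgeom hs0 (planarPeierlsConst_pos hc).le) h0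
          _ = _ := by ring
    _ = 2 * ((k : ℝ) + 2) * planarPeierlsConst c * Real.exp (-c * ((k : ℝ) + 3) / 4) := by ring

/-! ### The threshold: exponential decay below a positive error rate, for every loss rate below `1/2` -/

open Classical in
/-- A failure probability is at most one (planar instance of `ToricCode.mixedFailureProb_le_one`'s statement).
[cite: DennisEtAl2002, §4.4 eq. (prob_E)] -/
theorem planar_mixedFailureProb_le_one (D : ErasureDecoder (PlanarQubit k) (PlanarCheck k → ZMod 2)) {y p : ℝ}
    (hy0 : 0 ≤ y) (hy1 : y ≤ 1) (hp0 : 0 ≤ p) (hp1 : p ≤ 1) :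
    mixedFailureProb (planarHX k) (planarSZ k : Set (PlanarQubit k → ZMod 2)) D y p ≤ 1 :=
  ToricCode.mixedFailureProb_le_one _ _ _ hy0 hy1 hp0 hp1

/-- **For every loss rate below `1/2` the planar surface codes have a positive error threshold**, granted the odd-crossing
property of their non-trivial logicals (`k = 1`): for `0 ≤ y < 1/2` there is `p₀ > 0` such that for EVERY family of
minimum-weight-outside-the-losses decoders and every error rate `0 ≤ p ≤ p₀`, the failure probability of the `k`-th planar code
under losses `y` and errors `p` DECAYS EXPONENTIALLY in `k`. [cite: StaceBarrettDoherty2009, p. 3 and Fig. 2] [cite: StaceBarrett2010, abstract] [cite: KestenCMP1980, Thm. 2 (1.7)] -/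
theorem planar_mixedFamily_decaysExponentially_of_oddCrossing
    (hk1 : ∀ (k : ℕ) (x : PlanarQubit k → ZMod 2), planarHX k *ᵥ x = 0 → x ∉ planarSZ k →
      ∑ b : Fin (k + 2), x (Sum.inl (0, b)) = 1)
    {y : ℝ} (hy0 : 0 ≤ y) (hy : y < 1 / 2) :
    ∃ p₀ : ℝ, 0 < p₀ ∧ ∀ (D : (k : ℕ) → ErasureDecoder (PlanarQubit k) (PlanarCheck k → ZMod 2)),
      (∀ k, (D k).IsMinWeightOutside (planarHX k)) →
        ∀ p : ℝ, 0 ≤ p → p ≤ p₀ → DecaysExponentially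
          (fun k p => mixedFailureProb (planarHX k) (planarSZ k : Set (PlanarQubit k → ZMod 2)) (D k) y p) p := by
  have hy1 : y ≤ 1 := by linarith
  set q : unitInterval := ⟨y, hy0, hy1⟩ with hq
  obtain ⟨c, hc, hdec⟩ := Kesten1980_expDecay q (by simpa [hq] using hy)
  refine ⟨min (planarFlipThreshold c) 1, lt_min (planarFlipThreshold_pos hc) one_pos, fun D hD p hp0 hp => ?_⟩
  have hpt : p ≤ planarFlipThreshold c := hp.trans (min_le_left _ _)
  have hp1 : p ≤ 1 := hp.trans (min_le_right _ _)
  -- `P_k ≤ 2 (k+2) K e^{-c(k+3)/4} = B (k+1)^1 e^{-(c/4) k}` with `B = 2 K e^{-3c/4} · 2` (since k + 2 ≤ 2(k+1))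
  have hK := planarPeierlsConst_pos hc
  set Bc : ℝ := 4 * planarPeierlsConst c * Real.exp (-(3 * c / 4)) with hB
  refine decaysExponentially_of_abs_le_poly_mul_exp (m := 1) (c := c / 4) (B := Bc) (by positivity) fun k => ?_
  have hnn : 0 ≤ mixedFailureProb (planarHX k) (planarSZ k : Set (PlanarQubit k → ZMod 2)) (D k) y p := by
    unfold mixedFailureProb
    exact Finset.sum_nonneg fun Er _ => mul_nonneg (bernoulliWeight_nonneg hy0 hy1 _)
      (Finset.sum_nonneg fun E _ => bernoulliWeight_nonneg hp0 hp1 _)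
  rw [abs_of_nonneg hnn]
  have h := planar_mixedFailureProb_le_of_oneArmDecay (hk1 k) (hD k) q hc hdec hp0 hpt hp1
  refine h.trans ?_
  have he : Real.exp (-c * ((k : ℝ) + 3) / 4) = Real.exp (-(3 * c / 4)) * Real.exp (-(c / 4) * k) := by
    rw [← Real.exp_add]; congr 1; ring
  rw [he, pow_one]
  have hk2 : (k : ℝ) + 2 ≤ 2 * ((k : ℝ) + 1) := by linarith
  have hpos : 0 ≤ planarPeierlsConst c * (Real.exp (-(3 * c / 4)) * Real.exp (-(c / 4) * k)) := by positivity
  calc 2 * ((k : ℝ) + 2) * planarPeierlsConst c * (Real.exp (-(3 * c / 4)) * Real.exp (-(c / 4) * k))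
      = ((k : ℝ) + 2) * (2 * (planarPeierlsConst c * (Real.exp (-(3 * c / 4)) * Real.exp (-(c / 4) * k)))) := by ring
    _ ≤ (2 * ((k : ℝ) + 1)) * (2 * (planarPeierlsConst c * (Real.exp (-(3 * c / 4)) * Real.exp (-(c / 4) * k)))) :=
        mul_le_mul_of_nonneg_right hk2 (by positivity)
    _ = Bc * ((k : ℝ) + 1) * Real.exp (-(c / 4) * k) := by rw [hB]; ring

end PlanarCode

end Literature.InformationTheory.QuantumCodes
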